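import Mathlib
import Summits.Parity.BatemanHorn.Theses.IsogenyRedei
import Summits.Parity.BatemanHorn.Theorems.IsogenyRedeiSplitBlockJacobiWeylDefs
import Summits.Parity.BatemanHorn.Theorems.IsogenyRedeiSplitBlockJacobiWeylDeepReduction
import HarnessLib

/-!
# Crux `SplitBlockJacobi` (stmt-Parity-11583) — line `Ideate4Sketch` (card `salie-twist-absorption`):
# proof skeleton of the fourth line lead (unit line-stmt-Parity-11583-a2)

Composition (all names below are in namespace
`Summit.Parity.BatemanHorn.Cruxes.SplitBlockJacobi.SalieTwistAbsorption`; the crux vocabulary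
`rootWeylSum`, `twistedSum`, `TierWeylBound` is the tree's, from `…WeylDefs`):

* `stub_twistAbsorption` (identity, TRUE, M): for distinct primes `Q ≡ Q′ ≡ 1 (4)`, CRT inverses
  `Q′u₂ ≡ 1 (Q)`, `Qu₁ ≡ 1 (Q′)` and `gcd(h, Q) = 1`,
  `(Q|Q′)·S(h,QQ′) = (h|Q)·[(hu₂|Q)·S(hu₂,Q)]·S(hu₁,Q′)` — the Legendre kernel is ABSORBED into the
  Salié local factor `F_Q(a) = (a|Q)·S(a,Q)` (card §Lever; `(Q|Q′) = (Q′|Q) = (u₂|Q)`).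
* `stub_dividingRow` (identity, TRUE, S): for `Q ∣ h`, `S(h,QQ′) = 2·S(h/Q, Q′)` (the CRT factor at `Q`
  degenerates to `ρ(Q) = 2`).
* glue `twistedSum_eq_absorbed_add_dividing` (PROVED here from the two identities): on every box,
  `T_h = absorbedSum h + dividingRows h` — rows `Q ∤ h` in absorbed (Salié) form, off-diagonal; rows
  `Q ∣ h` as single sums `2·Σ_{Q′}(Q|Q′)S(h/Q,Q′)`.
* `stub_absorbedDeep` (OPEN — the card's `AbsorbedSquareRoot`, the line's deep residual, lead's stub):
  `‖absorbedSum h(box)‖ ≤ x^{1−ε₀}/2` on the deep tiers `μ < 2/3`, all boxes and frequencies of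
  `TierWeylBound`.
* `stub_dividingRowsDeep` (OPEN — single-row twisted DFI prime sums): the same bound for `dividingRows`.
* glue `tierWeylBound_of_bounds` (PROVED): the two bounds give `TierWeylBound θ μ` on the deep tiers;
  `SplitBlockJacobi_of` := the tree's `splitBlockJacobi_of_weylDeep` (R1 ⇒ crux, p94639) applied to it.

So the skeleton closes the crux modulo the four stubs; the two identities are this line's provable
content, the two bounds are R1 (`stub_weylDeep` of the dead line `cofactor-root-discrepancy`) split
along `Q ∤ h` / `Q ∣ h` and rewritten by exact identities — the card's own scope statement
("below the corner the absorbed form still needs JOINT square-root cancellation in (Q,Q′)").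
-/

noncomputable section

open Finset Filter

namespace Summit.Parity.BatemanHorn.Cruxes.SplitBlockJacobi.SalieTwistAbsorption

open Summit.Parity.BatemanHorn.Cruxes.SplitBlockJacobi.CofactorRootDiscrepancy
  (rootWeylSum twistedSum TierWeylBound splitBlockJacobi_of_weylDeep)

/-! ## Vocabulary of the absorbed form -/

/-- The canonical inverse of `a` modulo `q` as a natural number (`0` if not invertible):
the `val` of `(a : ZMod q)⁻¹`. -/
def inv (q a : ℕ) : ℕ := ((a : ZMod q)⁻¹).val

/-- The SALIÉ LOCAL FACTOR `F_Q(a) := (a|Q)·S(a,Q)` (`= (a|Q)·2cos(2π a ν_Q/Q)` for a prime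
`Q ≡ 1 (4)`): unit mean square on `(ℤ/Q)ˣ`, Gauss-flat Fourier transform (card §Lever). -/
def salieLocal (Q : ℕ) (a : ℤ) : ℂ := (jacobiSym a Q : ℂ) * rootWeylSum a Q

/-- The ABSORBED TERM `(h|Q)·F_Q(h·Q̄′)·S(h·Q̄, Q′)` with the canonical inverses
`Q̄′ = inv Q Q′ (mod Q)`, `Q̄ = inv Q′ Q (mod Q′)`. -/
def absorbedTerm (h : ℤ) (Q Q' : ℕ) : ℂ :=
  (jacobiSym h Q : ℂ) * salieLocal Q (h * (inv Q Q' : ℕ)) * rootWeylSum (h * (inv Q' Q : ℕ)) Q'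

/-- The ABSORBED BILINEAR FORM over a box of primes `≡ 1 (mod 4)`: rows `Q ∈ (P₁,P₁']` with `Q ∤ h`,
columns `Q′ ∈ (P₂,P₂']`, `Q′ ≠ Q`, summand `absorbedTerm h Q Q′` — an UNTWISTED
Duke–Friedlander–Iwaniec-shaped form with the Salié local factor at the row prime. -/
def absorbedSum (h : ℤ) (P₁ P₁' P₂ P₂' : ℕ) : ℂ :=
  ∑ Q ∈ ((Finset.Ioc P₁ P₁').filter (fun Q : ℕ => Q.Prime ∧ Q % 4 = 1)).filter
      (fun Q : ℕ => ¬ ((Q : ℤ) ∣ h)),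
    ∑ Q' ∈ ((Finset.Ioc P₂ P₂').filter (fun Q' : ℕ => Q'.Prime ∧ Q' % 4 = 1)).filter
        (fun Q' : ℕ => Q' ≠ Q),
      absorbedTerm h Q Q'

/-- The DIVIDING ROWS of the box: rows `Q ∣ h` (at most `log|h|/log P₁` of them), where the CRT factor
at `Q` degenerates and the summand is the single-modulus term `2·(Q|Q′)·S(h/Q, Q′)`. -/
def dividingRows (h : ℤ) (P₁ P₁' P₂ P₂' : ℕ) : ℂ :=
  ∑ Q ∈ ((Finset.Ioc P₁ P₁').filter (fun Q : ℕ => Q.Prime ∧ Q % 4 = 1)).filter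
      (fun Q : ℕ => (Q : ℤ) ∣ h),
    ∑ Q' ∈ ((Finset.Ioc P₂ P₂').filter (fun Q' : ℕ => Q'.Prime ∧ Q' % 4 = 1)).filter
        (fun Q' : ℕ => Q' ≠ Q),
      (jacobiSym (Q : ℤ) Q' : ℂ) * (2 * rootWeylSum (h / Q) Q')

/-! ## The stubs -/

/-- **Stub A — twist absorption** (card `salie-twist-absorption`, First lemma; TRUE, M-sized):
for distinct primes `Q ≡ Q′ ≡ 1 (mod 4)`, inverses `Q′u₂ ≡ 1 (mod Q)`, `Qu₁ ≡ 1 (mod Q′)` and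
`gcd(h,Q) = 1`: `(Q|Q′)·S(h,QQ′) = (h|Q)·((hu₂|Q)·S(hu₂,Q))·S(hu₁,Q′)`.
Ingredients: `rootWeylSum_mul_of_coprime` (tree, `…RootWeylSumCRT`), quadratic reciprocity for
`Q ≡ Q′ ≡ 1 (4)`, `(u₂|Q) = (Q′|Q)` from `Q′u₂ ≡ 1`, `(h|Q)² = 1`. -/
theorem stub_twistAbsorption :
    ∀ (h : ℤ) (Q Q' u₁ u₂ : ℕ), Q.Prime → Q'.Prime → Q % 4 = 1 → Q' % 4 = 1 → Q ≠ Q' →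
      Q' * u₂ ≡ 1 [MOD Q] → Q * u₁ ≡ 1 [MOD Q'] → Int.gcd h Q = 1 →
        (jacobiSym (Q : ℤ) Q' : ℂ) * (∑ ν ∈ (Finset.range (Q * Q')).filter (fun ν : ℕ => Q * Q' ∣ ν ^ 2 + 1), Complex.exp (2 * Real.pi * Complex.I * (h : ℂ) * (ν : ℂ) / ((Q * Q' : ℕ) : ℂ))) =
          (jacobiSym h Q : ℂ) * ((jacobiSym (h * u₂) Q : ℂ) * (∑ ν ∈ (Finset.range Q).filter (fun ν : ℕ => Q ∣ ν ^ 2 + 1), Complex.exp (2 * Real.pi * Complex.I * ((h * u₂ : ℤ) : ℂ) * (ν : ℂ) / (Q : ℂ)))) *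
            (∑ ν ∈ (Finset.range Q').filter (fun ν : ℕ => Q' ∣ ν ^ 2 + 1), Complex.exp (2 * Real.pi * Complex.I * ((h * u₁ : ℤ) : ℂ) * (ν : ℂ) / (Q' : ℂ))) := by
  sorry

/-- **Stub B — the degenerate CRT factor** (TRUE, S-sized): for distinct primes `Q, Q′` with
`Q ≡ 1 (mod 4)` and `Q ∣ h`, `S(h, QQ′) = 2·S(h/Q, Q′)` (the phase `e(hν/(QQ′)) = e((h/Q)ν/Q′)`
only sees `ν mod Q′`, and each root mod `Q′` has `ρ(Q) = 2` lifts). -/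
theorem stub_dividingRow :
    ∀ (h : ℤ) (Q Q' : ℕ), Q.Prime → Q'.Prime → Q % 4 = 1 → Q ≠ Q' → (Q : ℤ) ∣ h →
      ∑ ν ∈ (Finset.range (Q * Q')).filter (fun ν : ℕ => Q * Q' ∣ ν ^ 2 + 1), Complex.exp (2 * Real.pi * Complex.I * (h : ℂ) * (ν : ℂ) / ((Q * Q' : ℕ) : ℂ)) = 2 * (∑ ν ∈ (Finset.range Q').filter (fun ν : ℕ => Q' ∣ ν ^ 2 + 1), Complex.exp (2 * Real.pi * Complex.I * ((h / Q : ℤ) : ℂ) * (ν : ℂ) / (Q' : ℂ))) := by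
  sorry

/-- **Stub C — the absorbed deep residual** (the card's `AbsorbedSquareRoot`; OPEN, GRH-strength by the
card's own account: per row the needed saving is `P₂^{(1−μ)/(2−μ−θ)} > √P₂` for `μ < θ`, so the
cancellation must be joint in `(Q,Q′)` at square-root scale up to `x^{μ/2}`): on the deep tiers
`μ < 2/3`, for the boxes and frequencies of `TierWeylBound`, `‖absorbedSum h(box)‖ ≤ x^{1−ε₀}/2`. -/
theorem stub_absorbedDeep :
    ∀ θ μ : ℝ, 1 / 2 < θ → θ < 1 → 0 < μ → μ < 2 / 3 →
      ∃ ε₀ : ℝ, 0 < ε₀ ∧ ∃ x₀ : ℕ, ∀ x : ℕ, x₀ ≤ x → ∀ P₁ P₁' P₂ P₂' : ℕ,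
        (x : ℝ) ^ θ ≤ 2 * (P₁ : ℝ) → P₁ ≤ P₁' → P₁' ≤ 2 * P₁ → P₁ ≤ P₂ → P₂ ≤ P₂' → P₂' ≤ 2 * P₂ →
          ((P₁ * P₂ : ℕ) : ℝ) ≤ (x : ℝ) ^ (2 - μ) →
            ∀ h : ℤ, h ≠ 0 → (|h| : ℝ) ≤ ((P₁ * P₂ : ℕ) : ℝ) * (x : ℝ) ^ (ε₀ - 1) →
              ‖absorbedSum h P₁ P₁' P₂ P₂'‖ ≤ (x : ℝ) ^ (1 - ε₀) / 2 := by
  sorry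

/-- **Stub D — the dividing rows on the deep tiers** (OPEN: at most three rows, each a single sum
`2·Σ_{Q′ ~ P₂}(Q|Q′)S(h/Q,Q′)` over primes — a `χ_Q`-twisted Duke–Friedlander–Iwaniec prime sum; trivial
when `P₂ ≤ x^{1−2ε₀}`, and a row exists only if `|h| ≥ Q > P₁`, i.e. `P₂ ≥ x^{1−ε₀}`; needed saving up to
`P₂^{1/3}` as `μ → 0`, `θ → 1/2`): `‖dividingRows h(box)‖ ≤ x^{1−ε₀}/2`. -/
theorem stub_dividingRowsDeep :
    ∀ θ μ : ℝ, 1 / 2 < θ → θ < 1 → 0 < μ → μ < 2 / 3 →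
      ∃ ε₀ : ℝ, 0 < ε₀ ∧ ∃ x₀ : ℕ, ∀ x : ℕ, x₀ ≤ x → ∀ P₁ P₁' P₂ P₂' : ℕ,
        (x : ℝ) ^ θ ≤ 2 * (P₁ : ℝ) → P₁ ≤ P₁' → P₁' ≤ 2 * P₁ → P₁ ≤ P₂ → P₂ ≤ P₂' → P₂' ≤ 2 * P₂ →
          ((P₁ * P₂ : ℕ) : ℝ) ≤ (x : ℝ) ^ (2 - μ) →
            ∀ h : ℤ, h ≠ 0 → (|h| : ℝ) ≤ ((P₁ * P₂ : ℕ) : ℝ) * (x : ℝ) ^ (ε₀ - 1) →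
              ‖dividingRows h P₁ P₁' P₂ P₂'‖ ≤ (x : ℝ) ^ (1 - ε₀) / 2 := by
  sorry

/-! ## Glue (proved) -/

/-- `a · inv q a ≡ 1 (mod q)` for a prime `q` and `a` coprime to `q`. -/
theorem mul_inv_modEq {q a : ℕ} (hq : q.Prime) (ha : Nat.Coprime a q) :
    a * inv q a ≡ 1 [MOD q] := by
  haveI : NeZero q := ⟨hq.ne_zero⟩
  rw [← ZMod.natCast_eq_natCast_iff]
  push_cast
  unfold inv
  rw [ZMod.natCast_zmod_val, ZMod.coe_mul_inv_eq_one a ha]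

/-- `gcd(h, Q) = 1` for a prime `Q ∤ h`. -/
theorem int_gcd_eq_one_of_not_dvd {h : ℤ} {Q : ℕ} (hQ : Q.Prime) (hnd : ¬ ((Q : ℤ) ∣ h)) :
    Int.gcd h Q = 1 := by
  have hp : Prime (Q : ℤ) := Nat.prime_iff_prime_int.mp hQ
  have hc : IsCoprime (Q : ℤ) h := (Irreducible.coprime_iff_not_dvd hp.irreducible).mpr hnd
  exact Int.isCoprime_iff_gcd_eq_one.mp hc.symm

/-- `(Q|Q) = 0` for a prime `Q` (as a complex number). -/
theorem jacobiSym_self_cast_eq_zero {Q : ℕ} (hQ : Q.Prime) : (jacobiSym (Q : ℤ) Q : ℂ) = 0 := by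
  have : jacobiSym (Q : ℤ) Q = 0 :=
    jacobiSym.eq_zero_iff.mpr ⟨hQ.ne_zero, by rw [Int.gcd_natCast_natCast, Nat.gcd_self]; exact hQ.one_lt.ne'⟩
  rw [this]; simp

/-- **Glue 1 (bookkeeping).** Given the two identities (stubs A and B), on every box and for every
frequency the twisted root Weyl sum splits as `T_h = absorbedSum h + dividingRows h`: the diagonal
`Q′ = Q` vanishes (`(Q|Q) = 0`), rows `Q ∤ h` take the absorbed form with the canonical inverses, rows
`Q ∣ h` the degenerate form. -/
theorem twistedSum_eq_absorbed_add_dividing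
    (hA : ∀ (h : ℤ) (Q Q' u₁ u₂ : ℕ), Q.Prime → Q'.Prime → Q % 4 = 1 → Q' % 4 = 1 → Q ≠ Q' →
      Q' * u₂ ≡ 1 [MOD Q] → Q * u₁ ≡ 1 [MOD Q'] → Int.gcd h Q = 1 →
        (jacobiSym (Q : ℤ) Q' : ℂ) * (∑ ν ∈ (Finset.range (Q * Q')).filter (fun ν : ℕ => Q * Q' ∣ ν ^ 2 + 1), Complex.exp (2 * Real.pi * Complex.I * (h : ℂ) * (ν : ℂ) / ((Q * Q' : ℕ) : ℂ))) =
          (jacobiSym h Q : ℂ) * ((jacobiSym (h * u₂) Q : ℂ) * (∑ ν ∈ (Finset.range Q).filter (fun ν : ℕ => Q ∣ ν ^ 2 + 1), Complex.exp (2 * Real.pi * Complex.I * ((h * u₂ : ℤ) : ℂ) * (ν : ℂ) / (Q : ℂ)))) *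
            (∑ ν ∈ (Finset.range Q').filter (fun ν : ℕ => Q' ∣ ν ^ 2 + 1), Complex.exp (2 * Real.pi * Complex.I * ((h * u₁ : ℤ) : ℂ) * (ν : ℂ) / (Q' : ℂ))))
    (hB : ∀ (h : ℤ) (Q Q' : ℕ), Q.Prime → Q'.Prime → Q % 4 = 1 → Q ≠ Q' → (Q : ℤ) ∣ h →
      ∑ ν ∈ (Finset.range (Q * Q')).filter (fun ν : ℕ => Q * Q' ∣ ν ^ 2 + 1), Complex.exp (2 * Real.pi * Complex.I * (h : ℂ) * (ν : ℂ) / ((Q * Q' : ℕ) : ℂ)) = 2 * (∑ ν ∈ (Finset.range Q').filter (fun ν : ℕ => Q' ∣ ν ^ 2 + 1), Complex.exp (2 * Real.pi * Complex.I * ((h / Q : ℤ) : ℂ) * (ν : ℂ) / (Q' : ℂ))))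
    (h : ℤ) (P₁ P₁' P₂ P₂' : ℕ) :
    twistedSum h P₁ P₁' P₂ P₂' = absorbedSum h P₁ P₁' P₂ P₂' + dividingRows h P₁ P₁' P₂ P₂' := by
  unfold twistedSum absorbedSum dividingRows
  set S₁ := (Finset.Ioc P₁ P₁').filter (fun Q : ℕ => Q.Prime ∧ Q % 4 = 1) with hS₁
  set S₂ := (Finset.Ioc P₂ P₂').filter (fun Q' : ℕ => Q'.Prime ∧ Q' % 4 = 1) with hS₂
  -- drop the diagonal Q' = Q from every row
  have hdiag : ∀ Q ∈ S₁, ∑ Q' ∈ S₂, (jacobiSym (Q : ℤ) Q' : ℂ) * rootWeylSum h (Q * Q') =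
      ∑ Q' ∈ S₂.filter (fun Q' : ℕ => Q' ≠ Q), (jacobiSym (Q : ℤ) Q' : ℂ) * rootWeylSum h (Q * Q') := by
    intro Q hQ
    have hQp : Q.Prime := (Finset.mem_filter.mp hQ).2.1
    have hp : ∀ Q' ∈ S₂, (jacobiSym (Q : ℤ) Q' : ℂ) * rootWeylSum h (Q * Q') ≠ 0 → Q' ≠ Q := by
      intro Q' _ hne heq
      rw [heq, jacobiSym_self_cast_eq_zero hQp, zero_mul] at hne
      exact hne rfl
    rw [Finset.sum_filter_of_ne hp]
  rw [Finset.sum_congr rfl hdiag, ← Finset.sum_filter_add_sum_filter_not S₁ (fun Q : ℕ => (Q : ℤ) ∣ h),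
    add_comm]
  congr 1
  · -- rows Q ∤ h : absorbed form
    refine Finset.sum_congr rfl fun Q hQ => ?_
    rw [Finset.mem_filter] at hQ
    obtain ⟨hQS, hnd⟩ := hQ
    have hQp : Q.Prime := (Finset.mem_filter.mp hQS).2.1
    have hQ4 : Q % 4 = 1 := (Finset.mem_filter.mp hQS).2.2
    refine Finset.sum_congr rfl fun Q' hQ' => ?_
    rw [Finset.mem_filter] at hQ'
    obtain ⟨hQ'S, hne⟩ := hQ'
    have hQ'p : Q'.Prime := (Finset.mem_filter.mp hQ'S).2.1
    have hQ'4 : Q' % 4 = 1 := (Finset.mem_filter.mp hQ'S).2.2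
    have hu₂ : Q' * inv Q Q' ≡ 1 [MOD Q] :=
      mul_inv_modEq hQp ((Nat.coprime_primes hQ'p hQp).mpr hne)
    have hu₁ : Q * inv Q' Q ≡ 1 [MOD Q'] :=
      mul_inv_modEq hQ'p ((Nat.coprime_primes hQp hQ'p).mpr (Ne.symm hne))
    have e := hA h Q Q' (inv Q' Q) (inv Q Q') hQp hQ'p hQ4 hQ'4 (Ne.symm hne) hu₂ hu₁
      (int_gcd_eq_one_of_not_dvd hQp hnd)
    unfold absorbedTerm salieLocal
    simpa only [rootWeylSum] using e
  · -- rows Q ∣ h : degenerate form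
    refine Finset.sum_congr rfl fun Q hQ => ?_
    rw [Finset.mem_filter] at hQ
    obtain ⟨hQS, hd⟩ := hQ
    have hQp : Q.Prime := (Finset.mem_filter.mp hQS).2.1
    have hQ4 : Q % 4 = 1 := (Finset.mem_filter.mp hQS).2.2
    refine Finset.sum_congr rfl fun Q' hQ' => ?_
    rw [Finset.mem_filter] at hQ'
    obtain ⟨hQ'S, hne⟩ := hQ'
    have hQ'p : Q'.Prime := (Finset.mem_filter.mp hQ'S).2.1
    have e := hB h Q Q' hQp hQ'p hQ4 (Ne.symm hne) hd
    simp only [rootWeylSum]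
    rw [e]

/-- **Glue 2.** The two deep-tier bounds (stubs C and D), through Glue 1, give the dead line's R1 on the
deep tiers: `TierWeylBound θ μ` for all `θ ∈ (1/2,1)`, `μ ∈ (0,2/3)` (with `ε₀ = min`, `x₀ = max`). -/
theorem tierWeylBound_of_bounds
    (hA : ∀ (h : ℤ) (Q Q' u₁ u₂ : ℕ), Q.Prime → Q'.Prime → Q % 4 = 1 → Q' % 4 = 1 → Q ≠ Q' →
      Q' * u₂ ≡ 1 [MOD Q] → Q * u₁ ≡ 1 [MOD Q'] → Int.gcd h Q = 1 →
        (jacobiSym (Q : ℤ) Q' : ℂ) * (∑ ν ∈ (Finset.range (Q * Q')).filter (fun ν : ℕ => Q * Q' ∣ ν ^ 2 + 1), Complex.exp (2 * Real.pi * Complex.I * (h : ℂ) * (ν : ℂ) / ((Q * Q' : ℕ) : ℂ))) =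
          (jacobiSym h Q : ℂ) * ((jacobiSym (h * u₂) Q : ℂ) * (∑ ν ∈ (Finset.range Q).filter (fun ν : ℕ => Q ∣ ν ^ 2 + 1), Complex.exp (2 * Real.pi * Complex.I * ((h * u₂ : ℤ) : ℂ) * (ν : ℂ) / (Q : ℂ)))) *
            (∑ ν ∈ (Finset.range Q').filter (fun ν : ℕ => Q' ∣ ν ^ 2 + 1), Complex.exp (2 * Real.pi * Complex.I * ((h * u₁ : ℤ) : ℂ) * (ν : ℂ) / (Q' : ℂ))))
    (hB : ∀ (h : ℤ) (Q Q' : ℕ), Q.Prime → Q'.Prime → Q % 4 = 1 → Q ≠ Q' → (Q : ℤ) ∣ h →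
      ∑ ν ∈ (Finset.range (Q * Q')).filter (fun ν : ℕ => Q * Q' ∣ ν ^ 2 + 1), Complex.exp (2 * Real.pi * Complex.I * (h : ℂ) * (ν : ℂ) / ((Q * Q' : ℕ) : ℂ)) = 2 * (∑ ν ∈ (Finset.range Q').filter (fun ν : ℕ => Q' ∣ ν ^ 2 + 1), Complex.exp (2 * Real.pi * Complex.I * ((h / Q : ℤ) : ℂ) * (ν : ℂ) / (Q' : ℂ))))
    (hC : ∀ θ μ : ℝ, 1 / 2 < θ → θ < 1 → 0 < μ → μ < 2 / 3 →
      ∃ ε₀ : ℝ, 0 < ε₀ ∧ ∃ x₀ : ℕ, ∀ x : ℕ, x₀ ≤ x → ∀ P₁ P₁' P₂ P₂' : ℕ,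
        (x : ℝ) ^ θ ≤ 2 * (P₁ : ℝ) → P₁ ≤ P₁' → P₁' ≤ 2 * P₁ → P₁ ≤ P₂ → P₂ ≤ P₂' → P₂' ≤ 2 * P₂ →
          ((P₁ * P₂ : ℕ) : ℝ) ≤ (x : ℝ) ^ (2 - μ) →
            ∀ h : ℤ, h ≠ 0 → (|h| : ℝ) ≤ ((P₁ * P₂ : ℕ) : ℝ) * (x : ℝ) ^ (ε₀ - 1) →
              ‖absorbedSum h P₁ P₁' P₂ P₂'‖ ≤ (x : ℝ) ^ (1 - ε₀) / 2)
    (hD : ∀ θ μ : ℝ, 1 / 2 < θ → θ < 1 → 0 < μ → μ < 2 / 3 →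
      ∃ ε₀ : ℝ, 0 < ε₀ ∧ ∃ x₀ : ℕ, ∀ x : ℕ, x₀ ≤ x → ∀ P₁ P₁' P₂ P₂' : ℕ,
        (x : ℝ) ^ θ ≤ 2 * (P₁ : ℝ) → P₁ ≤ P₁' → P₁' ≤ 2 * P₁ → P₁ ≤ P₂ → P₂ ≤ P₂' → P₂' ≤ 2 * P₂ →
          ((P₁ * P₂ : ℕ) : ℝ) ≤ (x : ℝ) ^ (2 - μ) →
            ∀ h : ℤ, h ≠ 0 → (|h| : ℝ) ≤ ((P₁ * P₂ : ℕ) : ℝ) * (x : ℝ) ^ (ε₀ - 1) →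
              ‖dividingRows h P₁ P₁' P₂ P₂'‖ ≤ (x : ℝ) ^ (1 - ε₀) / 2) :
    ∀ θ μ : ℝ, 1 / 2 < θ → θ < 1 → 0 < μ → μ < 2 / 3 → TierWeylBound θ μ := by
  intro θ μ hθ₁ hθ₂ hμ₁ hμ₂
  obtain ⟨ε₁, hε₁, x₁, H₁⟩ := hC θ μ hθ₁ hθ₂ hμ₁ hμ₂
  obtain ⟨ε₂, hε₂, x₂, H₂⟩ := hD θ μ hθ₁ hθ₂ hμ₁ hμ₂
  refine ⟨min ε₁ ε₂, lt_min hε₁ hε₂, max (max x₁ x₂) 1, ?_⟩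
  intro x hx P₁ P₁' P₂ P₂' hb₁ hb₂ hb₃ hb₄ hb₅ hb₆ hb₇ h hh hhle
  have hx₁ : x₁ ≤ x := le_trans (le_trans (le_max_left _ _) (le_max_left _ _)) hx
  have hx₂ : x₂ ≤ x := le_trans (le_trans (le_max_right _ _) (le_max_left _ _)) hx
  have hx1 : (1 : ℝ) ≤ (x : ℝ) := by exact_mod_cast le_trans (le_max_right _ _) hx
  have hP : (0 : ℝ) ≤ ((P₁ * P₂ : ℕ) : ℝ) := by positivity
  have hh₁ : (|h| : ℝ) ≤ ((P₁ * P₂ : ℕ) : ℝ) * (x : ℝ) ^ (ε₁ - 1) :=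
    hhle.trans (mul_le_mul_of_nonneg_left
      (Real.rpow_le_rpow_of_exponent_le hx1 (by linarith [min_le_left ε₁ ε₂])) hP)
  have hh₂ : (|h| : ℝ) ≤ ((P₁ * P₂ : ℕ) : ℝ) * (x : ℝ) ^ (ε₂ - 1) :=
    hhle.trans (mul_le_mul_of_nonneg_left
      (Real.rpow_le_rpow_of_exponent_le hx1 (by linarith [min_le_right ε₁ ε₂])) hP)
  have hb₁' := H₁ x hx₁ P₁ P₁' P₂ P₂' hb₁ hb₂ hb₃ hb₄ hb₅ hb₆ hb₇ h hh hh₁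
  have hb₂' := H₂ x hx₂ P₁ P₁' P₂ P₂' hb₁ hb₂ hb₃ hb₄ hb₅ hb₆ hb₇ h hh hh₂
  have hm₁ : (x : ℝ) ^ (1 - ε₁) ≤ (x : ℝ) ^ (1 - min ε₁ ε₂) :=
    Real.rpow_le_rpow_of_exponent_le hx1 (by linarith [min_le_left ε₁ ε₂])
  have hm₂ : (x : ℝ) ^ (1 - ε₂) ≤ (x : ℝ) ^ (1 - min ε₁ ε₂) :=
    Real.rpow_le_rpow_of_exponent_le hx1 (by linarith [min_le_right ε₁ ε₂])
  rw [twistedSum_eq_absorbed_add_dividing hA hB h P₁ P₁' P₂ P₂']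
  calc ‖absorbedSum h P₁ P₁' P₂ P₂' + dividingRows h P₁ P₁' P₂ P₂'‖
      ≤ ‖absorbedSum h P₁ P₁' P₂ P₂'‖ + ‖dividingRows h P₁ P₁' P₂ P₂'‖ := norm_add_le _ _
    _ ≤ (x : ℝ) ^ (1 - ε₁) / 2 + (x : ℝ) ^ (1 - ε₂) / 2 := add_le_add hb₁' hb₂'
    _ ≤ (x : ℝ) ^ (1 - min ε₁ ε₂) / 2 + (x : ℝ) ^ (1 - min ε₁ ε₂) / 2 := by linarith
    _ = (x : ℝ) ^ (1 - min ε₁ ε₂) := by ring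

/-- **The composition: the four stubs close the crux BY NAME.** Stubs C, D (bounds) and A, B
(identities) give R1 on the deep tiers (`tierWeylBound_of_bounds`), and the tree's
`splitBlockJacobi_of_weylDeep` (antitonicity in μ + `stub_poissonReduction` + R2 ⇒ crux, all landed)
gives `SplitBlockJacobi`. -/
theorem SplitBlockJacobi_of : Summit.Parity.BatemanHorn.Theses.IsogenyRedei.SplitBlockJacobi :=
  splitBlockJacobi_of_weylDeep
    (tierWeylBound_of_bounds stub_twistAbsorption stub_dividingRow stub_absorbedDeep
      stub_dividingRowsDeep)

end Summit.Parity.BatemanHorn.Cruxes.SplitBlockJacobi.SalieTwistAbsorption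

end
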